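import Summits.Ventures.CertifiedManyBodySolver.Rows.HomTorusTTPrimeEnergyDensity
import Summits.Ventures.CertifiedManyBodySolver.Rows.HomTorusTTPrimeCommutator
import Summits.Ventures.CertifiedManyBodySolver.Rows.TorusCeilingSectorEngine
import Summits.Ventures.CertifiedManyBodySolver.Rows.TorusCeilingCRT
import Summits.Ventures.CertifiedQuantumChemistry.Rows.SectorRows
import Literature.MathematicalPhysics.QuantumChemistry.SecondQuantizedHamiltonian
import HarnessLib

/-!
# Torus ceiling VII(c) — `t–t'` window certificates bound EVERY sector `(N↑, N↓)` of the `t–t'` tori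
# generated by an additive lattice map (sharp torus hypothesis)

HONEST FRAMING: first certified bounds; not a superconductivity verdict; every number certified or
labelled float. KERNEL column of the CAL ceiling page at `t' ≠ 0` (cal-3 item K7b): the rectangular
periodic `3 × 4` and `3 × 5` `t–t'` tori, which cap the footprint classes `(≤3,4)` and `(≤3,5)` at the
companion cell `(U, n, t') = (8, 7/8, −1/4)`, were so far only a paper argument for `t' ≠ 0` (the kernel's
`TorusCeilingCRT` / `TorusCeilingTiltSectors` rows are nearest-neighbour). This file proves, for every
additive `φ : ℤ² →+ (ℤ/Nℤ)^{d'}` with non-degenerate nearest-neighbour AND diagonal hops and every window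
`Λ'` on which `φ` is injective (only), that a translation + EOM window certificate of the `t–t'` Hubbard
model (data of the tree's `groundEnergy_hubbardTorusTT'_div_ge_of_window_certificate`, interaction
`hubbardTTPrimeFermionInteraction t t' U` of Xu et al. 2024 eq. (1)) bounds the energy per site of
`homHubbardTT' φ t t' U` (`HomTorusTTPrimeModel`) in EVERY joint sector `(N, S^z) = (a + b, (a − b)/2)`:
* `homTorusTT'_minEnergyOn_upDownSector_div_ge_of_window_certificate` (+ the spin-averaged `_avg` form,
  `minEnergyOn_homHubbardTT'_spinSwap`);
* the CRT rows themselves (`3 × 4`: ring `ℤ/12`, `3 × 5`: ring `ℤ/15`) are `TorusCeilingTTPrimeCRT`.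
Mechanism: Han's translation averaging (Han 2020 §3) on the sector-abstracted torus engine
`torus_minEnergyOn_sector_div_ge_of_local_certificate`, Parts I–III `HomTorusTTPrime{Model,
EnergyDensity,Commutator}`; patterned on `TorusCeilingHom` / `TorusCeilingCRT` (nearest neighbour) and
`TorusCeilingTTPrimeSectors` (`φ = x ↦ x mod L`). USE (cal-3 `report/kernel_caps.py` v10): the periodic
`3 × 4` / `3 × 5` `t' = −1/4` ED rows in every sector `(a, b)` with `a ≤ 3` are KERNEL-admissible caps of
the footprint classes `(≤3,4)` / `(≤3,5)` at `t' ≠ 0`; the numerical rows themselves are ED references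
(certified or labelled float), not part of this file. Not covered (correctly): twisted (AP/PA/AA,
spin-twisted) `t–t'` rows, which need a `t–t'` flux model. [cite: Han2020Bootstrap, §3]
[cite: XuEtAl2024, eq. (1)] [cite: LiebPRL1989, proof of Theorem 1] [cite: KullEtAl2024, §5.3]

Also: the diagonal hop residues of the CRT rings, `crtHom34 ∘ D = ringHom 12 ![13, −5]` etc.
(`ringHom_comp_diagMap`, `crtHom34|43|35|53_comp_diagMap`), shared by the two row files. -/

noncomputable section

open Matrix Finset
open Literature.MathematicalPhysics.QuantumLattice
open Literature.MathematicalPhysics.QuantumFieldTheory hiding Site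
open Literature.MathematicalPhysics.QuantumManyBody.StateRelaxation
open Literature.Probability.LatticeModels
open HubbardWave0
open scoped ComplexOrder ComplexConjugate

namespace Summit.Ventures.CertifiedManyBodySolver.Rows

/-! ### Window certificate ⇒ every sector `(N↑, N↓)` of the `t–t'` torus generated by `φ` -/

section TTPrimeHomSectors

variable {d' N : ℕ} [NeZero N]

/-- **`t–t'` window certificate ⇒ energy per site of the torus generated by `φ` in EVERY sector
`(N↑, N↓) = (a, b)`, sharp torus hypothesis.** Fix `φ : ℤ² →+ (ℤ/Nℤ)^{d'}` with non-degenerate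
nearest-neighbour hops (`±φ e₀, ±φ e₁` pairwise distinct) and non-degenerate diagonal hops (`±φ j₀, ±φ j₁`
pairwise distinct), a window `Λ' ⊆ ℤ²` containing the unit cube `thicken {0} 1` on which `φ` is injective
(ONLY — not on `thicken Λ' 1`), an inner region `Λ ⊆ Λ'` with all eight king-move neighbours of every
site of `Λ` inside `Λ'` (`thicken Λ 1 ⊆ Λ'`), real `μ_↑, μ_↓, ν`, and the identity in `𝔄_{Λ'}` of the
tree's `groundEnergy_hubbardTorusTT'_div_ge_of_window_certificate` (objective `Γ(incl) E^{tt'}_Φ`, Gram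
form, EOM rows `H^{tt'}_{Λ'} Bₖ − Bₖ H^{tt'}_{Λ'}` with `Bₖ ∈ 𝔄_Λ`, translation rows, charged words,
anti-Hermitian parts, residual words). Then for every `a, b ≤ N^{d'}`:
`c − Σₖ ‖aₖ‖ + μ_↑ (a/N^{d'} − ν) + μ_↓ (b/N^{d'} − ν) ≤ minEnergyOn (homHubbardTT' φ t t' U) (szSector (a+b) ((a−b)/2)) / N^{d'}`.
Proof: Han's translation averaging on the sector-abstracted engine
`torus_minEnergyOn_sector_div_ge_of_local_certificate` — the translates of `Γ(ι) E^{tt'}_Φ` sum to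
`homHubbardTT' φ t t' U` (`sum_relabel_translate_homEmb_TTPrime_meanEnergyObs`, where non-degeneracy
enters), translation rows become the symmetry defects of `U_{φ v}`, EOM rows transport by the sharp
commutator lemma `homHubbardTT'_commutator_fermionEmbed`, charged words are commutators with the conserved
`N̂` / `S^z`, and `N_σ` acts as `a` resp. `b` on the sector
(`CertifiedQuantumChemistry.spinNumber_mulVec_of_mem_upDownSector`; the sector is non-trivial —
`QuantumChemistry.szSector_upDown_ne_bot`). [cite: Han2020Bootstrap, §3] [cite: XuEtAl2024, eq. (1)]
[cite: LiebPRL1989, eq. (2)] -/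
theorem homTorusTT'_minEnergyOn_upDownSector_div_ge_of_window_certificate (φ : Site 2 →+ TorusSite d' N)
    (t t' U : ℝ) (hd : Function.Injective (signedHop φ)) (hd' : Function.Injective (signedHop (φ.comp diagMap)))
    {nu nd : ℕ} (hnu : nu ≤ Fintype.card (FermionTorus d' N)) (hnd : nd ≤ Fintype.card (FermionTorus d' N))
    {Λ Λ' : Finset (Site 2)} (hΛ : Λ ⊆ Λ') (h8 : thicken Λ 1 ⊆ Λ')
    (h0 : thicken ({0} : Finset (Site 2)) 1 ⊆ Λ') (hz : (0 : Site 2) ∈ Λ')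
    (hInj' : Set.InjOn φ ↑Λ')
    (μ : Fin 2 → ℝ) (ν : ℝ)
    {m : Type*} [Fintype m] [DecidableEq m] {Λm : Matrix m m ℂ} (hΛm : Λm.PosSemidef)
    (O : m → FermionOp Λ')
    {κ : Type*} (s : Finset κ) (B : κ → FermionOp Λ)
    {ι : Type*} (tt : Finset ι) (v : ι → Site 2) (hsh : ∀ l, shiftSet (v l) Λ ⊆ Λ') (Y : ι → FermionOp Λ)
    {γ : Type*} (u : Finset γ) (b : γ → ℂ) (cw : γ → List (Orb (PolySite Λ') × Bool))
    (hcw : ∀ j ∈ u, ladderCharge (cw j) ≠ 0 ∨ ladderSpinCharge (cw j) ≠ 0)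
    {δ : Type*} (ah : Finset δ) (dc : δ → ℝ) (V : δ → FermionOp Λ')
    {κ'' : Type*} (w : Finset κ'') (a : κ'' → ℂ) (word : κ'' → List (Orb (PolySite Λ') × Bool)) {c : ℝ}
    (hcert : fermionEmbed (PolySite.incl h0) ((hubbardTTPrimeFermionInteraction t t' U).meanEnergyObs 1) -
        (c : ℂ) • (1 : FermionOp Λ') -
        ∑ σ : Fin 2, ((μ σ : ℝ) : ℂ) • (nAt 0 hz σ - ((ν : ℝ) : ℂ) • (1 : FermionOp Λ')) =
      gramForm Λm O +
        (∑ k ∈ s, ((hubbardTTPrimeFermionInteraction t t' U).localHamiltonian Λ' * fermionEmbed (PolySite.incl hΛ) (B k) -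
            fermionEmbed (PolySite.incl hΛ) (B k) * (hubbardTTPrimeFermionInteraction t t' U).localHamiltonian Λ') +
          ∑ l ∈ tt, (fermionEmbed (PolySite.incl (hsh l)) (fermionEmbed (PolySite.shiftEmb (v l) Λ) (Y l)) -
            fermionEmbed (PolySite.incl hΛ) (Y l)) +
          ∑ j ∈ u, b j • ladderWord (cw j)) +
        (∑ m' ∈ ah, ((dc m' : ℝ) : ℂ) • ((V m')ᴴ - V m') + ∑ k ∈ w, a k • ladderWord (word k))) :
    c - ∑ k ∈ w, ‖a k‖ + (μ 0 * ((nu : ℝ) / (N : ℝ) ^ d' - ν) + μ 1 * ((nd : ℝ) / (N : ℝ) ^ d' - ν)) ≤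
      (homHubbardTT' φ t t' U).minEnergyOn (szSector (nu + nd) (((nu : ℝ) - nd) / 2)) / (N : ℝ) ^ d' := by
  letI instDE : DecidableEq (FermionTorus d' N) := LinearOrder.toDecidableEq
  -- the pull-back homomorphism and its restrictions
  have hInjΛ : Set.InjOn φ ↑Λ := hInj'.mono (by exact_mod_cast hΛ)
  have hInj0 : Set.InjOn φ ↑(thicken ({0} : Finset (Site 2)) 1) := hInj'.mono (by exact_mod_cast h0)
  set Γ' := fermionEmbed (homEmb φ hInj') with hΓ'
  set ΓΛ := fermionEmbed (homEmb φ hInjΛ) with hΓΛ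
  set H := homHubbardTT' φ t t' U with hH
  set EΦ := (hubbardTTPrimeFermionInteraction t t' U).meanEnergyObs 1 with hEΦ
  -- the sector
  set K : Submodule ℂ (Fock (Orb (FermionTorus d' N))) := szSector (nu + nd) (((nu : ℝ) - nd) / 2) with hKdef
  have hK : K ≠ ⊥ := Literature.MathematicalPhysics.QuantumChemistry.szSector_upDown_ne_bot hnu hnd
  -- Hamiltonian data
  have hA : H.IsHermitian := homHubbardTT'_isHermitian φ t t' U
  have hKA : ∀ ψ ∈ K, H *ᵥ ψ ∈ K := fun ψ hψ => mulVec_homHubbardTT'_mem_szSector φ t t' U hψ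
  have hKT : ∀ v' : TorusSite d' N, ∀ ψ ∈ K, (fockTranslate v').val *ᵥ ψ ∈ K :=
    fun v' ψ hψ => fockTranslate_mulVec_mem_szSector v' hψ
  have hKT' : ∀ v' : TorusSite d' N, ∀ ψ ∈ K, (fockTranslate v').valᴴ *ᵥ ψ ∈ K :=
    fun v' ψ hψ => fockTranslate_conjTranspose_mulVec_mem_szSector v' hψ
  have hAT : ∀ v' : TorusSite d' N, (fockTranslate v').val * H = H * (fockTranslate v').val := fun v' =>
    fockTranslate_mul_homHubbardTT' φ v' t t' U
  -- the objective: `Γ' (Γ(incl) E_Φ) = Γ(ι₀) E_Φ`, whose translates sum to `H`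
  set X := Γ' (fermionEmbed (PolySite.incl h0) EΦ) with hX
  have hX0 : X = fermionEmbed (homEmb φ hInj0) EΦ := fermionEmbed_homEmb_incl φ h0 hInj' EΦ
  have hsum : ∑ v' : TorusSite d' N, (fockTranslate v').val * X * (fockTranslate v').valᴴ = H := by
    rw [hX0]
    have h := sum_relabel_translate_homEmb_TTPrime_meanEnergyObs φ t t' U hInj0 hd hd'
    simp_rw [relabel_eq_fockRelabel_conj] at h
    exact h
  -- density observables, acting as `nu` resp. `nd` on the sector
  set D : Fin 2 → Matrix (Finset (Orb (FermionTorus d' N))) (Finset (Orb (FermionTorus d' N))) ℂ :=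
    fun σ => numberOp (FermionTorus.ofTorusSite (0 : TorusSite d' N)) σ with hD
  set G : Fin 2 → Matrix (Finset (Orb (FermionTorus d' N))) (Finset (Orb (FermionTorus d' N))) ℂ :=
    fun σ => ∑ y : FermionTorus d' N, numberOp y σ with hG
  set gv : Fin 2 → ℝ := fun σ => if σ = 0 then (nu : ℝ) else (nd : ℝ) with hgv
  have hDΓ : ∀ σ, Γ' (nAt 0 hz σ) = D σ := fun σ => fermionEmbed_homEmb_nAt_zero φ hz hInj' σ
  have hDsum : ∀ σ ∈ (Finset.univ : Finset (Fin 2)),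
      ∑ v' : TorusSite d' N, (fockTranslate v').val * D σ * (fockTranslate v').valᴴ = G σ :=
    fun σ _ => sum_conj_fockTranslate_numberOp 0 σ
  have hGh : ∀ σ ∈ (Finset.univ : Finset (Fin 2)), (G σ).IsHermitian := fun σ _ => isHermitian_sum_numberOp σ
  have hGs : ∀ σ ∈ (Finset.univ : Finset (Fin 2)), ∀ ψ ∈ K, G σ *ᵥ ψ = (((gv σ : ℝ) : ℝ) : ℂ) • ψ := by
    intro σ _ ψ hψ
    rw [hG, hgv]
    exact Summit.Ventures.CertifiedQuantumChemistry.spinNumber_mulVec_of_mem_upDownSector σ hψ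
  -- symmetry (translation) family
  set Us : ι → Matrix (Finset (Orb (FermionTorus d' N))) (Finset (Orb (FermionTorus d' N))) ℂ :=
    fun l => (fockTranslate (φ (v l))).val with hUs
  set Yt : ι → Matrix (Finset (Orb (FermionTorus d' N))) (Finset (Orb (FermionTorus d' N))) ℂ :=
    fun l => ΓΛ (Y l) with hYt
  have hU : ∀ l ∈ tt, Us l * H = H * Us l := fun l _ => hAT _
  have hUK : ∀ l ∈ tt, ∀ ψ ∈ K, Us l *ᵥ ψ ∈ K := fun l _ ψ hψ => fockTranslate_mulVec_mem_szSector _ hψ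
  have hUK' : ∀ l ∈ tt, ∀ ψ ∈ K, (Us l)ᴴ *ᵥ ψ ∈ K :=
    fun l _ ψ hψ => fockTranslate_conjTranspose_mulVec_mem_szSector _ hψ
  have hUU : ∀ l ∈ tt, (Us l)ᴴ * Us l = 1 := fun l _ => fockTranslate_conjTranspose_mul_self _
  -- charge family (charged words as commutators with `N̂` / `S^z`)
  set emb : Orb (PolySite Λ') × Bool → Orb (FermionTorus d' N) × Bool :=
    fun p => (Orb.embMap (homEmb φ hInj') p.1, p.2) with hemb
  set C : γ → Matrix (Finset (Orb (FermionTorus d' N))) (Finset (Orb (FermionTorus d' N))) ℂ :=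
    fun j => if ladderCharge ((cw j).map emb) ≠ 0 then totalNumber else HubbardWave0.spinZ with hC
  set W : γ → Matrix (Finset (Orb (FermionTorus d' N))) (Finset (Orb (FermionTorus d' N))) ℂ :=
    fun j => (b j / (if ladderCharge ((cw j).map emb) ≠ 0 then ((ladderCharge ((cw j).map emb) : ℤ) : ℂ)
      else ((ladderSpinCharge ((cw j).map emb) : ℤ) : ℂ) / 2)) • ladderWord ((cw j).map emb) with hW
  have hHN : Commute H totalNumber := homHubbardTT'_commute_totalNumber φ t t' U
  have hHS : Commute H HubbardWave0.spinZ := homHubbardTT'_commute_spinZ φ t t' U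
  have hC1 : ∀ j ∈ u, C j * H = H * C j := by
    intro j _
    by_cases hq : ladderCharge ((cw j).map emb) ≠ 0
    · simp only [hC, hq, ne_eq, not_false_eq_true, if_true]; exact hHN.symm.eq
    · simp only [hC, hq, if_false]; exact hHS.symm.eq
  have hCK : ∀ j ∈ u, ∀ ψ ∈ K, C j *ᵥ ψ ∈ K := by
    intro j _ ψ hψ
    obtain ⟨hNψ, hSψ⟩ := (mem_szSector_iff _ _ ψ).1 hψ
    by_cases hq : ladderCharge ((cw j).map emb) ≠ 0
    · simp only [hC, hq, ne_eq, not_false_eq_true, if_true]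
      rw [totalNumber_mulVec_of_isNParticle hNψ]
      exact Submodule.smul_mem _ _ hψ
    · simp only [hC, hq, if_false]
      rw [hSψ]
      exact Submodule.smul_mem _ _ hψ
  have hCh : ∀ j, (C j)ᴴ = C j := by
    intro j
    by_cases hq : ladderCharge ((cw j).map emb) ≠ 0
    · simp only [hC, hq, ne_eq, not_false_eq_true, if_true]
      rw [totalNumber_eq_numberDiag_univ]
      exact numberDiag_conjTranspose _
    · simp only [hC, hq, if_false]; exact HubbardWave0.spinZ_isHermitian.eq
  have hCK' : ∀ j ∈ u, ∀ ψ ∈ K, (C j)ᴴ *ᵥ ψ ∈ K := fun j hj ψ hψ => by rw [hCh j]; exact hCK j hj ψ hψ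
  have hcharged : ∀ j ∈ u, Γ' (b j • ladderWord (cw j)) = C j * W j - W j * C j := by
    intro j hj
    rw [map_smul, hΓ', fermionEmbed_ladderWord]
    have hl : ladderCharge ((cw j).map emb) ≠ 0 ∨ ladderSpinCharge ((cw j).map emb) ≠ 0 := by
      rw [hemb, ladderCharge_map_embMap, ladderSpinCharge_map_embMap]; exact hcw j hj
    exact smul_ladderWord_eq_commutator_of_charged (b j) _ hl
  -- residual words
  set Mw : κ'' → Matrix (Finset (Orb (FermionTorus d' N))) (Finset (Orb (FermionTorus d' N))) ℂ :=
    fun k => ladderWord ((word k).map emb) with hMw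
  have hMc : ∀ k ∈ w, (Mw k).IsContraction := fun k _ => by
    rw [hMw]; dsimp only; rw [ladderWord_eq_prod]; exact isContraction_prod_ladder _
  -- the identity, pulled back into the torus (EOM rows by the SHARP commutator lemma)
  have htorus : X - (c : ℂ) • (1 : Matrix (Finset (Orb (FermionTorus d' N))) (Finset (Orb (FermionTorus d' N))) ℂ) -
      ∑ σ ∈ (Finset.univ : Finset (Fin 2)), ((μ σ : ℝ) : ℂ) • (D σ - ((ν : ℝ) : ℂ) •
        (1 : Matrix (Finset (Orb (FermionTorus d' N))) (Finset (Orb (FermionTorus d' N))) ℂ)) =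
      gramForm Λm (fun i => Γ' (O i)) +
        (∑ k ∈ s, (H * Γ' (fermionEmbed (PolySite.incl hΛ) (B k)) - Γ' (fermionEmbed (PolySite.incl hΛ) (B k)) * H) +
          ∑ l ∈ tt, (Us l * Yt l * (Us l)ᴴ - Yt l) +
          ∑ i ∈ (∅ : Finset (Fin 0)), ((0 : Matrix _ _ ℂ) * ((0 : Matrix _ _ ℂ) - (((0 : ℝ) : ℝ) : ℂ) • 1) +
            ((0 : Matrix _ _ ℂ) - (((0 : ℝ) : ℝ) : ℂ) • 1) * (0 : Matrix _ _ ℂ)) +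
          ∑ j ∈ u, (C j * W j - W j * C j)) +
        (∑ m' ∈ ah, ((dc m' : ℝ) : ℂ) • ((Γ' (V m'))ᴴ - Γ' (V m')) + ∑ k ∈ w, a k • Mw k) := by
    have key := congrArg Γ' hcert
    -- left-hand side
    rw [map_sub, map_sub, map_smul, map_one, map_sum] at key
    have hlhs : ∑ σ : Fin 2, Γ' (((μ σ : ℝ) : ℂ) • (nAt 0 hz σ - ((ν : ℝ) : ℂ) • (1 : FermionOp Λ'))) =
        ∑ σ ∈ (Finset.univ : Finset (Fin 2)), ((μ σ : ℝ) : ℂ) • (D σ - ((ν : ℝ) : ℂ) •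
          (1 : Matrix (Finset (Orb (FermionTorus d' N))) (Finset (Orb (FermionTorus d' N))) ℂ)) :=
      Finset.sum_congr rfl fun σ _ => by rw [map_smul, map_sub, map_smul, map_one, hDΓ]
    rw [hlhs] at key
    -- right-hand side, family by family
    have h1 : Γ' (∑ k ∈ s, ((hubbardTTPrimeFermionInteraction t t' U).localHamiltonian Λ' * fermionEmbed (PolySite.incl hΛ) (B k) -
        fermionEmbed (PolySite.incl hΛ) (B k) * (hubbardTTPrimeFermionInteraction t t' U).localHamiltonian Λ')) =
        ∑ k ∈ s, (H * Γ' (fermionEmbed (PolySite.incl hΛ) (B k)) - Γ' (fermionEmbed (PolySite.incl hΛ) (B k)) * H) := by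
      rw [map_sum]
      refine Finset.sum_congr rfl fun k _ => ?_
      rw [hH, hΓ', homHubbardTT'_commutator_fermionEmbed φ t t' U hΛ h8 hInj' (B k)]
    have h2 : Γ' (∑ l ∈ tt, (fermionEmbed (PolySite.incl (hsh l)) (fermionEmbed (PolySite.shiftEmb (v l) Λ) (Y l)) -
        fermionEmbed (PolySite.incl hΛ) (Y l))) = ∑ l ∈ tt, (Us l * Yt l * (Us l)ᴴ - Yt l) := by
      rw [map_sum]
      refine Finset.sum_congr rfl fun l _ => ?_
      rw [hUs, hYt, hΓΛ, hΓ']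
      exact fermionEmbed_homEmb_shift_sub φ hΛ (v l) (hsh l) hInj' (Y l)
    have h3 : Γ' (∑ j ∈ u, b j • ladderWord (cw j)) = ∑ j ∈ u, (C j * W j - W j * C j) := by
      rw [map_sum]
      exact Finset.sum_congr rfl hcharged
    have h4 : Γ' (∑ m' ∈ ah, ((dc m' : ℝ) : ℂ) • ((V m')ᴴ - V m')) =
        ∑ m' ∈ ah, ((dc m' : ℝ) : ℂ) • ((Γ' (V m'))ᴴ - Γ' (V m')) := by
      rw [map_sum]
      refine Finset.sum_congr rfl fun m' _ => ?_
      rw [map_smul, map_sub, hΓ', fermionEmbed_conjTranspose]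
    have h5 : Γ' (∑ k ∈ w, a k • ladderWord (word k)) = ∑ k ∈ w, a k • Mw k := by
      rw [map_sum]
      refine Finset.sum_congr rfl fun k _ => ?_
      rw [map_smul, hMw, hΓ', fermionEmbed_ladderWord]
    rw [hX, key, map_add, map_add, map_add, map_add, map_add, hΓ', fermionEmbed_gramForm, ← hΓ', h1, h2, h3, h4, h5,
      Finset.sum_empty, add_zero]
  -- apply the sector-abstracted torus engine
  have hmain := torus_minEnergyOn_sector_div_ge_of_local_certificate H hA K hK hKA hKT hKT' hAT X hsum
    (Finset.univ : Finset (Fin 2)) μ (fun _ => ν) gv D G hDsum hGh hGs hΛm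
    (fun i => Γ' (O i)) s (fun k => Γ' (fermionEmbed (PolySite.incl hΛ) (B k))) tt Us Yt hU hUK hUK' hUU
    (∅ : Finset (Fin 0)) (fun _ => 0) (fun _ => 0) (fun _ => 0) (fun _ => 0)
    (fun i hi => absurd hi (Finset.notMem_empty i)) (fun i hi => absurd hi (Finset.notMem_empty i))
    u C W hC1 hCK hCK' ah dc (fun m' => Γ' (V m')) w a Mw hMc htorus
  have hs : ∑ σ ∈ (Finset.univ : Finset (Fin 2)), μ σ * (gv σ / (N : ℝ) ^ d' - ν) =
      μ 0 * ((nu : ℝ) / (N : ℝ) ^ d' - ν) + μ 1 * ((nd : ℝ) / (N : ℝ) ^ d' - ν) := by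
    rw [Fin.sum_univ_two, hgv]
    simp only [Fin.isValue, if_true, one_ne_zero, if_false]
  rw [hs] at hmain
  exact hmain


omit [NeZero N] in
/-- **`E^{tt'}_φ(b, a) = E^{tt'}_φ(a, b)`**: the spin exchange carries the sector `(N↑, N↓) = (a, b)` of
the `t–t'` torus generated by `φ` onto the sector `(b, a)`. [cite: LiebPRL1989, proof of Theorem 1] -/
theorem minEnergyOn_homHubbardTT'_spinSwap (φ : Site 2 →+ TorusSite d' N) (t t' U : ℝ) (a b : ℕ) :
    (homHubbardTT' φ t t' U).minEnergyOn (szSector (b + a) (((b : ℝ) - a) / 2)) =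
      (homHubbardTT' φ t t' U).minEnergyOn (szSector (a + b) (((a : ℝ) - b) / 2)) := by
  rw [add_comm b a, show ((b : ℝ) - a) / 2 = -(((a : ℝ) - b) / 2) by ring]
  exact minEnergyOn_szSector_neg_of_relabel_spinSwap (relabel_spinSwap_homHubbardTT' φ t t' U) _ _

/-- **Spin-averaged form: EVERY sector `(N↑, N↓) = (a, b)` of the `t–t'` torus generated by `φ`,
density rows at the mean filling, sharp torus hypothesis.** Averaging
`homTorusTT'_minEnergyOn_upDownSector_div_ge_of_window_certificate` over `(a, b)` and `(b, a)`
(`E^{tt'}_φ(b, a) = E^{tt'}_φ(a, b)` by the spin exchange):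
`c − Σ‖aₖ‖ + (Σ_σ μ_σ)((a + b)/2 / N^{d'} − ν) ≤ minEnergyOn (homHubbardTT' φ t t' U) (szSector (a+b) ((a−b)/2)) / N^{d'}`.
At the certificate's filling `(a + b)/(2N^{d'}) = ν` the density rows drop out: the certified constant
of a translation + EOM `t–t'` window certificate is a lower bound for the energy density of the `t–t'`
torus generated by `φ` in every particle-number sector at that filling (cal-3 kernel column K7: the
`3 × 4` / `3 × 5` PP `t' = −1/4` caps of the classes `(≤3,4)` / `(≤3,5)` via the CRT rings below).
[cite: Han2020Bootstrap, §3] [cite: XuEtAl2024, eq. (1)] [cite: LiebPRL1989, proof of Theorem 1] -/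
theorem homTorusTT'_minEnergyOn_upDownSector_div_ge_of_window_certificate_avg (φ : Site 2 →+ TorusSite d' N)
    (t t' U : ℝ) (hd : Function.Injective (signedHop φ)) (hd' : Function.Injective (signedHop (φ.comp diagMap)))
    {nu nd : ℕ} (hnu : nu ≤ Fintype.card (FermionTorus d' N)) (hnd : nd ≤ Fintype.card (FermionTorus d' N))
    {Λ Λ' : Finset (Site 2)} (hΛ : Λ ⊆ Λ') (h8 : thicken Λ 1 ⊆ Λ')
    (h0 : thicken ({0} : Finset (Site 2)) 1 ⊆ Λ') (hz : (0 : Site 2) ∈ Λ')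
    (hInj' : Set.InjOn φ ↑Λ')
    (μ : Fin 2 → ℝ) (ν : ℝ)
    {m : Type*} [Fintype m] [DecidableEq m] {Λm : Matrix m m ℂ} (hΛm : Λm.PosSemidef)
    (O : m → FermionOp Λ')
    {κ : Type*} (s : Finset κ) (B : κ → FermionOp Λ)
    {ι : Type*} (tt : Finset ι) (v : ι → Site 2) (hsh : ∀ l, shiftSet (v l) Λ ⊆ Λ') (Y : ι → FermionOp Λ)
    {γ : Type*} (u : Finset γ) (b : γ → ℂ) (cw : γ → List (Orb (PolySite Λ') × Bool))
    (hcw : ∀ j ∈ u, ladderCharge (cw j) ≠ 0 ∨ ladderSpinCharge (cw j) ≠ 0)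
    {δ : Type*} (ah : Finset δ) (dc : δ → ℝ) (V : δ → FermionOp Λ')
    {κ'' : Type*} (w : Finset κ'') (a : κ'' → ℂ) (word : κ'' → List (Orb (PolySite Λ') × Bool)) {c : ℝ}
    (hcert : fermionEmbed (PolySite.incl h0) ((hubbardTTPrimeFermionInteraction t t' U).meanEnergyObs 1) -
        (c : ℂ) • (1 : FermionOp Λ') -
        ∑ σ : Fin 2, ((μ σ : ℝ) : ℂ) • (nAt 0 hz σ - ((ν : ℝ) : ℂ) • (1 : FermionOp Λ')) =
      gramForm Λm O +
        (∑ k ∈ s, ((hubbardTTPrimeFermionInteraction t t' U).localHamiltonian Λ' * fermionEmbed (PolySite.incl hΛ) (B k) -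
            fermionEmbed (PolySite.incl hΛ) (B k) * (hubbardTTPrimeFermionInteraction t t' U).localHamiltonian Λ') +
          ∑ l ∈ tt, (fermionEmbed (PolySite.incl (hsh l)) (fermionEmbed (PolySite.shiftEmb (v l) Λ) (Y l)) -
            fermionEmbed (PolySite.incl hΛ) (Y l)) +
          ∑ j ∈ u, b j • ladderWord (cw j)) +
        (∑ m' ∈ ah, ((dc m' : ℝ) : ℂ) • ((V m')ᴴ - V m') + ∑ k ∈ w, a k • ladderWord (word k))) :
    c - ∑ k ∈ w, ‖a k‖ + (∑ σ : Fin 2, μ σ) * (((nu : ℝ) + nd) / 2 / (N : ℝ) ^ d' - ν) ≤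
      (homHubbardTT' φ t t' U).minEnergyOn (szSector (nu + nd) (((nu : ℝ) - nd) / 2)) / (N : ℝ) ^ d' := by
  have h1 := homTorusTT'_minEnergyOn_upDownSector_div_ge_of_window_certificate φ t t' U hd hd' hnu hnd hΛ h8 h0 hz
    hInj' μ ν hΛm O s B tt v hsh Y u b cw hcw ah dc V w a word hcert
  have h2 := homTorusTT'_minEnergyOn_upDownSector_div_ge_of_window_certificate φ t t' U hd hd' hnd hnu hΛ h8 h0 hz
    hInj' μ ν hΛm O s B tt v hsh Y u b cw hcw ah dc V w a word hcert
  rw [minEnergyOn_homHubbardTT'_spinSwap φ t t' U nu nd] at h2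
  have e : ((nu : ℝ) + nd) / 2 / (N : ℝ) ^ d' = ((nu : ℝ) / (N : ℝ) ^ d' + (nd : ℝ) / (N : ℝ) ^ d') / 2 := by
    ring
  rw [Fin.sum_univ_two, e]
  linarith

end TTPrimeHomSectors

/-! ### The diagonal hops of the CRT rings `ℤ/12`, `ℤ/15` (used by the `3 × 4` / `3 × 5` rows of
`TorusCeilingTTPrimeCRT` / `TorusCeilingTTPrimeCRTRect`) -/

section CRTDiag

/-- The diagonal hops of a hop-residue ring: `(x ↦ Σ xᵢ pᵢ) ∘ D = x ↦ x₀ (p₀ + p₁) + x₁ (p₀ − p₁)`.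
[folklore] -/
theorem ringHom_comp_diagMap (N : ℕ) (p : Fin 2 → ℤ) :
    (ringHom N p).comp diagMap = ringHom N ![p 0 + p 1, p 0 - p 1] := by
  refine AddMonoidHom.ext fun x => funext fun j => ?_
  rw [AddMonoidHom.comp_apply, ringHom_apply, ringHom_apply, Fin.sum_univ_two, Fin.sum_univ_two, diagMap_apply,
    diagMap_apply]
  simp only [Fin.isValue, if_true, one_ne_zero, if_false, Matrix.cons_val_zero, Matrix.cons_val_one]
  congr 1
  ring

/-- The diagonal hops of the CRT ring of the `3 × 4` PP torus: `x ↦ 13x₀ − 5x₁ mod 12`, i.e. signed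
diagonal hops `{±1, ∓5}` (`(1,1) ↦ 4 + 9 = 13 ≡ 1`, `(1,−1) ↦ 4 − 9 = −5`). [folklore] -/
theorem crtHom34_comp_diagMap : crtHom34.comp diagMap = ringHom 12 ![13, -5] :=
  (ringHom_comp_diagMap 12 ![4, 9]).trans (by norm_num)

/-- The diagonal hops of the CRT ring of the `3 × 5` PP torus: `x ↦ 16x₀ + 4x₁ mod 15`, signed diagonal
hops `{±1, ±4}`. [folklore] -/
theorem crtHom35_comp_diagMap : crtHom35.comp diagMap = ringHom 15 ![16, 4] :=
  (ringHom_comp_diagMap 15 ![10, 6]).trans (by norm_num)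

/-- The diagonal hops of the transposed CRT ring of the `4 × 3`-oriented torus: `x ↦ 13x₀ + 5x₁ mod 12`,
signed diagonal hops `{±1, ±5}` (the same hop SET as for `crtHom34`). [folklore] -/
theorem crtHom43_comp_diagMap : crtHom43.comp diagMap = ringHom 12 ![13, 5] :=
  (ringHom_comp_diagMap 12 ![9, 4]).trans (by norm_num)

/-- The diagonal hops of the transposed CRT ring of the `5 × 3`-oriented torus: `x ↦ 16x₀ − 4x₁ mod 15`,
signed diagonal hops `{±1, ∓4}`. [folklore] -/
theorem crtHom53_comp_diagMap : crtHom53.comp diagMap = ringHom 15 ![16, -4] :=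
  (ringHom_comp_diagMap 15 ![6, 10]).trans (by norm_num)

end CRTDiag

end Summit.Ventures.CertifiedManyBodySolver.Rows

end
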